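import Mathlib.Analysis.SpecialFunctions.Exp
import Literature.RepresentationTheory.FiniteGroups.VershikKerovMaxDegree
import Literature.RepresentationTheory.FiniteGroups.VershikKerovLimitShape
import Summits.MatrixMultiplication.MatrixMultiplication.Theses.SnSubsetDichotomy
import Summits.MatrixMultiplication.MatrixMultiplication.Theses.SnThresholdCensus

/-!
# `SnSubsetDichotomy.VershikKerovBound` — the Vershik–Kerov upper bound for `d_max(S_n)`

Item `stmt-MatrixMultiplication-5540` (support, shared with route `SnThresholdCensus`):
`∃ c > 0, ∃ n₀, ∀ n ≥ n₀, d_max(S_n) ≤ √(n!)·e^{-c√n}`, where `d_max = maxCharDegree` is the largest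
degree of an irreducible complex character of `S_n`.

This is the `ε := c₂/2` instance of the upper half of the tree THEOREM
`Literature.RepresentationTheory.FiniteGroups.VershikKerov1985_maxCharDegree_holds`
(Vershik–Kerov 1985, Thm. 1, as quoted in Pak–Panova–Yeliussizov 2019, §2.3:
for every `ε > 0` and all large `n`, `√(n!)e^{-(c₁+ε)√n} ≤ D(n) ≤ √(n!)e^{-(c₂-ε)√n}`,
`c₂ = vkUpperConst = (π-2)/π² > 0`), with `c := c₂/2`.  The result is therefore UNCONDITIONAL
(the named fact is discharged in `VershikKerovLimitShape.lean`).

The item is shared with route `SnThresholdCensus`, whose decl `SnThresholdCensus.VershikKerovBound`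
is the same proposition verbatim; `vershikKerovBound_census_proof` records it for that route's
`closes`.
-/

-- `Summit.<Summit>.<Problem>` is the tree's mandated summit-side namespace; for this
-- single-conjunct summit the two coincide, so the file silences `dupNamespace`.
set_option linter.dupNamespace false

namespace Summit.MatrixMultiplication.MatrixMultiplication.Theorems

open Literature.RepresentationTheory.FiniteGroups in
/-- **Vershik–Kerov bound** (item `stmt-MatrixMultiplication-5540`): there are `c > 0` and `n₀` such
that for all `n ≥ n₀` the largest irreducible character degree of `S_n` is at most
`√(n!)·exp(-c√n)`.  Proof: the upper half of `VershikKerov1985_maxCharDegree_holds` at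
`ε := vkUpperConst/2`, so `c = vkUpperConst/2 = (π-2)/(2π²)`. -/
theorem vershikKerovBound_proof :
    Summit.MatrixMultiplication.MatrixMultiplication.Theses.SnSubsetDichotomy.VershikKerovBound := by
  unfold Summit.MatrixMultiplication.MatrixMultiplication.Theses.SnSubsetDichotomy.VershikKerovBound
  have hc : 0 < vkUpperConst / 2 := half_pos vkUpperConst_pos
  obtain ⟨n₀, hn₀⟩ := VershikKerov1985_maxCharDegree_holds (vkUpperConst / 2) hc
  refine ⟨vkUpperConst / 2, hc, n₀, fun n hn => ?_⟩
  have h := (hn₀ n hn).2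
  have hsub : vkUpperConst - vkUpperConst / 2 = vkUpperConst / 2 := by ring
  rwa [hsub] at h

/-- The same bound for route `SnThresholdCensus` (shared item `stmt-MatrixMultiplication-5540`):
its decl `SnThresholdCensus.VershikKerovBound` is the identical proposition, so the proof is
`vershikKerovBound_proof` up to unfolding. -/
theorem vershikKerovBound_census_proof :
    Summit.MatrixMultiplication.MatrixMultiplication.Theses.SnThresholdCensus.VershikKerovBound :=
  vershikKerovBound_proof

end Summit.MatrixMultiplication.MatrixMultiplication.Theorems
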